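import Literature.Analysis.FluidPDE.PassiveScalarEnergyMollified
import Literature.Analysis.FluidPDE.PassiveScalarForcedClass
import HarnessLib

/-!
# The mollified equation with datum for SOURCED weak passive scalars

Analysis/FluidPDE proof-support file (everything proved). The sourced counterpart
(`Torus.IsWeakScalarTransportForcedOn`, `∂ₜθ + u·∇θ = κΔθ + s`) of the first half of
`PassiveScalarEnergyMollified`: for a weak solution `θ ∈ L^∞(0,T; L²(T^d))` with datum `θ₀`,
source `s ∈ L¹((0,T) × T^d)` and a smooth kernel `k`, writing `A(t, x) = ∫ θ(t,y) k(x-y) dy`,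
`G(τ, x) = ∫ θ(τ,y) (-⟪u(τ,y), ∇k(x-y)⟫ + κ Δk(x-y)) dy` and `(s(τ) ⋆ k)(x) = ∫ s(τ,y) k(x-y) dy`,

* testing the weak formulation with `η(t) k(x₀ - ·)` gives
  `∫_{(0,T)} (η' A(·,x₀) + η (G(·,x₀) + (s ⋆ k)(·,x₀))) + η(0) (θ₀ ⋆ k)(x₀) = 0`
  (`setIntegral_test_molInt_eq`);
* the a.e. du Bois-Reymond lemma with datum and continuity in `x` give, for `θ₀ ∈ L¹`, a.e. `t`
  and *all* `x`: `A(t, x) = (θ₀ ⋆ k)(x) + ∫_{(0,t]} (G(τ, x) + (s(τ) ⋆ k)(x)) dτ`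
  (`ae_forall_molInt_eq_datum_add_setIntegral_flux`): the mollified equation
  `∂ₜ(θ ⋆ k) = -(div(uθ)) ⋆ k + κ Δ(θ ⋆ k) + s ⋆ k` integrated in time, pointwise in `x`.

This is the common first step of the renormalised energy inequality and of pairing identities
for sourced scalars (DiPerna–Lions 1989, §II.1 and proof of Thm. II.2; Bonicatto–Ciampa–Crippa
2023, proof of Thm. 3.3, (3.1)), e.g. for the steadily sourced scalar of the age-decoupling
argument (`FluidPDE/AgeDecouplingInequality`).

## References

* R. J. DiPerna, P.-L. Lions, Invent. Math. 98 (1989), 511–547, §II.1. [`DiPernaLions1989`]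
* P. Bonicatto, G. Ciampa, G. Crippa, J. Evol. Equ. 24 (2024), proof of Thm. 3.3, (3.1).
  [`BonicattoCiampaCrippa2023`]
* H. Brezis, *Functional Analysis, Sobolev Spaces and PDE* (2011), Lemma 8.1. [`Brezis2011`]
-/

noncomputable section

open _root_.MeasureTheory _root_.TopologicalSpace _root_.Set _root_.Function _root_.Filter _root_.Metric
open _root_.Topology
open scoped ENNReal NNReal Convolution ContDiff InnerProductSpace

namespace Literature.Analysis.FluidPDE

namespace Torus

variable {d : Type*} [Fintype d]

namespace IsWeakScalarTransportForcedOn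

variable {T κ : ℝ} {u : ℝ → UnitAddTorus d → EuclideanSpace ℝ d} {s : ℝ → UnitAddTorus d → ℝ}
  {θ₀ : UnitAddTorus d → ℝ} {θ : ℝ → UnitAddTorus d → ℝ}

/-! ## Integrability of the tested integrands -/

/-- Integrability on `(0,T) × T^d` of `θ(t,y) (-⟪u(t,y), ∇k(x₀ - y)⟫ + κ Δk(x₀ - y))` for smooth
`k` (the flux integrand `G`; sourced class). [folklore] -/
theorem integrable_mul_flux (h : IsWeakScalarTransportForcedOn T κ u s θ₀ θ) {k : UnitAddTorus d → ℝ}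
    (hk : FunctionSpaces.Torus.IsSmooth k) (x₀ : UnitAddTorus d) :
    Integrable (fun p : ℝ × UnitAddTorus d => θ p.1 p.2 *
      (-⟪u p.1 p.2, FunctionSpaces.Torus.gradient k (x₀ - p.2)⟫_ℝ + κ * FunctionSpaces.Torus.laplacian k (x₀ - p.2)))
      (((volume : Measure ℝ).restrict (Ioo 0 T)).prod volume) := by
  obtain ⟨C₂, hC₂⟩ := FunctionSpaces.Torus.exists_forall_norm_le_of_continuous hk.gradient.continuous
  obtain ⟨C₃, hC₃⟩ := FunctionSpaces.Torus.exists_forall_norm_le_of_continuous hk.laplacian.continuous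
  have hmu := h.aestronglyMeasurable_uncurry_velocity
  have hm : AEStronglyMeasurable (fun p : ℝ × UnitAddTorus d => θ p.1 p.2 *
      (-⟪u p.1 p.2, FunctionSpaces.Torus.gradient k (x₀ - p.2)⟫_ℝ + κ * FunctionSpaces.Torus.laplacian k (x₀ - p.2)))
      (((volume : Measure ℝ).restrict (Ioo 0 T)).prod volume) := by
    refine h.aestronglyMeasurable_uncurry.mul ((hmu.inner ?_).neg.add ?_)
    · exact (hk.gradient.continuous.comp (continuous_const.sub continuous_snd)).aestronglyMeasurable
    · exact (continuous_const.mul (hk.laplacian.continuous.comp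
        (continuous_const.sub continuous_snd))).aestronglyMeasurable
  refine Integrable.mono' (g := fun p : ℝ × UnitAddTorus d =>
      C₂ * ‖‖u p.1 p.2‖ * θ p.1 p.2‖ + |κ| * C₃ * ‖uncurry θ p‖)
    ((h.integrable_norm_velocity_mul.norm.const_mul C₂).add
      (h.integrable_uncurry.norm.const_mul (|κ| * C₃))) hm ?_
  refine Eventually.of_forall fun p => ?_
  simp only [uncurry, Real.norm_eq_abs, abs_mul, abs_norm]
  have h2 : |⟪u p.1 p.2, FunctionSpaces.Torus.gradient k (x₀ - p.2)⟫_ℝ| ≤ ‖u p.1 p.2‖ * C₂ :=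
    (abs_real_inner_le_norm _ _).trans (mul_le_mul_of_nonneg_left (hC₂ _) (norm_nonneg _))
  have h3 : |κ * FunctionSpaces.Torus.laplacian k (x₀ - p.2)| ≤ |κ| * C₃ := by
    rw [abs_mul]
    exact mul_le_mul_of_nonneg_left (by simpa [Real.norm_eq_abs] using hC₃ (x₀ - p.2)) (abs_nonneg _)
  calc |θ p.1 p.2| * |-⟪u p.1 p.2, FunctionSpaces.Torus.gradient k (x₀ - p.2)⟫_ℝ + κ * FunctionSpaces.Torus.laplacian k (x₀ - p.2)|
      ≤ |θ p.1 p.2| * (‖u p.1 p.2‖ * C₂ + |κ| * C₃) := by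
        refine mul_le_mul_of_nonneg_left ((abs_add_le _ _).trans (add_le_add (by rwa [abs_neg]) h3))
          (abs_nonneg _)
    _ = C₂ * (‖u p.1 p.2‖ * |θ p.1 p.2|) + |κ| * C₃ * |θ p.1 p.2| := by ring

/-! ## Testing a sourced solution with `η(t) k(x₀ - ·)` -/

/-- **The time-distributional identity with datum and source, at a point.** Testing the sourced
weak formulation with `η(t) k(x₀ - ·)`: for every `x₀` and every smooth compactly supported `η`
with `tsupport η ⊆ (-∞, T)`,
`∫_{(0,T)} (η' A(·, x₀) + η (G(·, x₀) + ∫ s(·,y) k(x₀-y) dy)) + η(0) (θ₀ ⋆ k)(x₀) = 0`, where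
`A(t, x₀) = ∫ θ(t,y) k(x₀-y) dy`, `G(t, x₀) = ∫ θ(t,y) (-⟪u(t,y), ∇k(x₀-y)⟫ + κ Δk(x₀-y)) dy`
(the mollified equation `∂ₜ(θ ⋆ k) = -(div(uθ)) ⋆ k + κ Δ(θ ⋆ k) + s ⋆ k` in distributional form
in time; DiPerna–Lions 1989, §II.1). [cite: DiPernaLions1989, §II.1 (13)–(14)] -/
theorem setIntegral_test_molInt_eq (h : IsWeakScalarTransportForcedOn T κ u s θ₀ θ) {η : ℝ → ℝ}
    (hη : ContDiff ℝ ∞ η) (hηc : HasCompactSupport η) (hηT : tsupport η ⊆ Iio T)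
    {k : UnitAddTorus d → ℝ} (hk : FunctionSpaces.Torus.IsSmooth k) (x₀ : UnitAddTorus d) :
    (∫ t in Ioo 0 T, ((deriv η t * ∫ y, θ t y * k (x₀ - y)) +
      η t * ((∫ y, θ t y * (-⟪u t y, FunctionSpaces.Torus.gradient k (x₀ - y)⟫_ℝ +
        κ * FunctionSpaces.Torus.laplacian k (x₀ - y))) + ∫ y, s t y * k (x₀ - y)))) +
      η 0 * ∫ y, θ₀ y * k (x₀ - y) = 0 := by
  have hψ := isSpaceTimeTest_mul_comp_sub hη hηc hηT hk x₀
  have hk1 : FunctionSpaces.Torus.IsContDiff 1 k := hk.isContDiff (by simp)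
  have key := h.integral_prod_weak_eq hψ
  have hkc : Continuous fun y : UnitAddTorus d => k (x₀ - y) := hk.continuous.comp (continuous_const.sub continuous_id)
  have hI₁ : Integrable (fun p : ℝ × UnitAddTorus d => θ p.1 p.2 * k (x₀ - p.2))
      (((volume : Measure ℝ).restrict (Ioo 0 T)).prod volume) := h.integrable_mul_continuous hkc
  have hI₂ := h.integrable_mul_flux hk x₀
  have hI₃ : Integrable (fun p : ℝ × UnitAddTorus d => s p.1 p.2 * k (x₀ - p.2))
      (((volume : Measure ℝ).restrict (Ioo 0 T)).prod volume) := h.integrable_source_mul_continuous hkc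
  have hpt : ∀ p : ℝ × UnitAddTorus d, θ p.1 p.2 *
      (FunctionSpaces.Torus.timeDeriv (fun t y => η t * k (x₀ - y)) p.1 p.2 +
        ⟪u p.1 p.2, FunctionSpaces.Torus.gradient ((fun t y => η t * k (x₀ - y)) p.1) p.2⟫_ℝ +
        κ * FunctionSpaces.Torus.laplacian ((fun t y => η t * k (x₀ - y)) p.1) p.2) =
      deriv η p.1 * (θ p.1 p.2 * k (x₀ - p.2)) +
        η p.1 * (θ p.1 p.2 *
          (-⟪u p.1 p.2, FunctionSpaces.Torus.gradient k (x₀ - p.2)⟫_ℝ + κ * FunctionSpaces.Torus.laplacian k (x₀ - p.2))) := by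
    intro p
    rw [timeDeriv_mul_comp_sub, gradient_mul_comp_sub hk1, laplacian_mul_comp_sub hk,
      inner_neg_right, real_inner_smul_right]
    ring
  have hps : ∀ p : ℝ × UnitAddTorus d, s p.1 p.2 * (fun t y => η t * k (x₀ - y)) p.1 p.2 =
      η p.1 * (s p.1 p.2 * k (x₀ - p.2)) := fun p => by simp only; ring
  have hdatum : ∫ x, θ₀ x * (fun t y => η t * k (x₀ - y)) 0 x = η 0 * ∫ y, θ₀ y * k (x₀ - y) := by
    rw [← MeasureTheory.integral_const_mul]
    refine integral_congr_ae (Eventually.of_forall fun x => ?_)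
    dsimp only
    ring
  set P : Measure (ℝ × UnitAddTorus d) := ((volume : Measure ℝ).restrict (Ioo 0 T)).prod volume
    with hP
  obtain ⟨Ca, hCa⟩ := (hη.continuous_deriv (by simp)).bounded_above_of_compact_support hηc.deriv
  obtain ⟨Cb, hCb⟩ := hη.continuous.bounded_above_of_compact_support hηc
  set f : ℝ × UnitAddTorus d → ℝ := fun p => deriv η p.1 * (θ p.1 p.2 * k (x₀ - p.2)) with hf_def
  set g : ℝ × UnitAddTorus d → ℝ := fun p => η p.1 * (θ p.1 p.2 *
    (-⟪u p.1 p.2, FunctionSpaces.Torus.gradient k (x₀ - p.2)⟫_ℝ + κ * FunctionSpaces.Torus.laplacian k (x₀ - p.2))) with hg_def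
  set r : ℝ × UnitAddTorus d → ℝ := fun p => η p.1 * (s p.1 p.2 * k (x₀ - p.2)) with hr_def
  have hf : Integrable f P :=
    hI₁.bdd_mul ((hη.continuous_deriv (by simp)).comp continuous_fst).aestronglyMeasurable
      (Eventually.of_forall fun p => hCa p.1)
  have hg : Integrable g P :=
    hI₂.bdd_mul (hη.continuous.comp continuous_fst).aestronglyMeasurable
      (Eventually.of_forall fun p => hCb p.1)
  have hr : Integrable r P :=
    hI₃.bdd_mul (hη.continuous.comp continuous_fst).aestronglyMeasurable
      (Eventually.of_forall fun p => hCb p.1)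
  have esum : (∫ p, (f p + g p) ∂P) + (∫ p, r p ∂P) + η 0 * ∫ y, θ₀ y * k (x₀ - y) = 0 := by
    have e1 : ∫ p, (f p + g p) ∂P = ∫ p, θ p.1 p.2 *
        (FunctionSpaces.Torus.timeDeriv (fun t y => η t * k (x₀ - y)) p.1 p.2 +
          ⟪u p.1 p.2, FunctionSpaces.Torus.gradient ((fun t y => η t * k (x₀ - y)) p.1) p.2⟫_ℝ +
          κ * FunctionSpaces.Torus.laplacian ((fun t y => η t * k (x₀ - y)) p.1) p.2) ∂P :=
      integral_congr_ae (Eventually.of_forall fun p => (hpt p).symm)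
    have e3 : ∫ p, r p ∂P = ∫ p, s p.1 p.2 * (fun t y => η t * k (x₀ - y)) p.1 p.2 ∂P :=
      integral_congr_ae (Eventually.of_forall fun p => (hps p).symm)
    rw [e1, e3, ← hdatum]
    exact key
  have ef : ∫ p, f p ∂P = ∫ t in Ioo 0 T, deriv η t * ∫ y, θ t y * k (x₀ - y) := by
    rw [hP, integral_prod _ hf]
    refine integral_congr_ae (Eventually.of_forall fun t => ?_)
    simp only [hf_def]
    exact MeasureTheory.integral_const_mul _ _
  have eg : ∫ p, g p ∂P = ∫ t in Ioo 0 T, η t * ∫ y, θ t y *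
      (-⟪u t y, FunctionSpaces.Torus.gradient k (x₀ - y)⟫_ℝ + κ * FunctionSpaces.Torus.laplacian k (x₀ - y)) := by
    rw [hP, integral_prod _ hg]
    refine integral_congr_ae (Eventually.of_forall fun t => ?_)
    simp only [hg_def]
    exact MeasureTheory.integral_const_mul _ _
  have er : ∫ p, r p ∂P = ∫ t in Ioo 0 T, η t * ∫ y, s t y * k (x₀ - y) := by
    rw [hP, integral_prod _ hr]
    refine integral_congr_ae (Eventually.of_forall fun t => ?_)
    simp only [hr_def]
    exact MeasureTheory.integral_const_mul _ _
  have ha : Integrable (fun t => deriv η t * ∫ y, θ t y * k (x₀ - y)) (volume.restrict (Ioo 0 T)) := by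
    refine hf.integral_prod_left.congr (Eventually.of_forall fun t => ?_)
    simp only [hf_def]
    exact MeasureTheory.integral_const_mul _ _
  have hb : Integrable (fun t => η t * ∫ y, θ t y *
      (-⟪u t y, FunctionSpaces.Torus.gradient k (x₀ - y)⟫_ℝ + κ * FunctionSpaces.Torus.laplacian k (x₀ - y)))
      (volume.restrict (Ioo 0 T)) := by
    refine hg.integral_prod_left.congr (Eventually.of_forall fun t => ?_)
    simp only [hg_def]
    exact MeasureTheory.integral_const_mul _ _
  have hc : Integrable (fun t => η t * ∫ y, s t y * k (x₀ - y)) (volume.restrict (Ioo 0 T)) := by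
    refine hr.integral_prod_left.congr (Eventually.of_forall fun t => ?_)
    simp only [hr_def]
    exact MeasureTheory.integral_const_mul _ _
  rw [integral_add hf hg, ef, eg, er] at esum
  have esplit : ∀ t, (deriv η t * ∫ y, θ t y * k (x₀ - y)) +
      η t * ((∫ y, θ t y * (-⟪u t y, FunctionSpaces.Torus.gradient k (x₀ - y)⟫_ℝ +
        κ * FunctionSpaces.Torus.laplacian k (x₀ - y))) + ∫ y, s t y * k (x₀ - y)) =
      ((deriv η t * ∫ y, θ t y * k (x₀ - y)) +
        η t * ∫ y, θ t y * (-⟪u t y, FunctionSpaces.Torus.gradient k (x₀ - y)⟫_ℝ +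
          κ * FunctionSpaces.Torus.laplacian k (x₀ - y))) + η t * ∫ y, s t y * k (x₀ - y) := fun t => by ring
  have hab : Integrable (fun t => (deriv η t * ∫ y, θ t y * k (x₀ - y)) +
      η t * ∫ y, θ t y * (-⟪u t y, FunctionSpaces.Torus.gradient k (x₀ - y)⟫_ℝ +
        κ * FunctionSpaces.Torus.laplacian k (x₀ - y))) (volume.restrict (Ioo 0 T)) := ha.add hb
  simp_rw [esplit]
  rw [integral_add hab hc, integral_add ha hb]
  linarith

/-! ## The time primitive with datum and source -/

/-- **du Bois-Reymond in time, at a point, with datum and source.** For every `x₀` and a.e.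
`t ∈ (0,T)`:
`∫ θ(t,y) k(x₀-y) dy = ∫ θ₀(y) k(x₀-y) dy + ∫_{(0,t]} (G(τ, x₀) + ∫ s(τ,y) k(x₀-y) dy) dτ`. [folklore] -/
theorem ae_molInt_eq_datum_add_setIntegral_flux (h : IsWeakScalarTransportForcedOn T κ u s θ₀ θ)
    {k : UnitAddTorus d → ℝ} (hk : FunctionSpaces.Torus.IsSmooth k) (x₀ : UnitAddTorus d) :
    ∀ᵐ t ∂(volume.restrict (Ioo 0 T)),
      ∫ y, θ t y * k (x₀ - y) = (∫ y, θ₀ y * k (x₀ - y)) +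
        ∫ τ in Ioc 0 t, ((∫ y, θ τ y *
          (-⟪u τ y, FunctionSpaces.Torus.gradient k (x₀ - y)⟫_ℝ + κ * FunctionSpaces.Torus.laplacian k (x₀ - y))) +
          ∫ y, s τ y * k (x₀ - y)) := by
  have hkc : Continuous fun y : UnitAddTorus d => k (x₀ - y) := hk.continuous.comp (continuous_const.sub continuous_id)
  have hU : IntegrableOn (fun t => ∫ y, θ t y * k (x₀ - y)) (Ioo 0 T) volume :=
    (h.integrable_mul_continuous hkc).integral_prod_left
  have hF : IntegrableOn (fun t => (∫ y, θ t y *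
      (-⟪u t y, FunctionSpaces.Torus.gradient k (x₀ - y)⟫_ℝ + κ * FunctionSpaces.Torus.laplacian k (x₀ - y))) +
      ∫ y, s t y * k (x₀ - y)) (Ioo 0 T) volume :=
    (h.integrable_mul_flux hk x₀).integral_prod_left.add (h.integrable_source_mul_continuous hkc).integral_prod_left
  exact FunctionSpaces.ae_eq_add_setIntegral_of_forall_test hU hF fun η hη hηc hηT =>
    h.setIntegral_test_molInt_eq hη hηc hηT hk x₀

/-- For a.e. `t ∈ (0,T)` the slice `θ t` is integrable together with `‖u t‖ θ t`, `u t` is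
a.e.-strongly measurable, and the source slice `s t` is integrable (sourced class). [folklore] -/
theorem ae_slice_integrable₁ (h : IsWeakScalarTransportForcedOn T κ u s θ₀ θ) :
    ∀ᵐ t ∂(volume.restrict (Ioo 0 T)), Integrable (θ t) volume ∧
      AEStronglyMeasurable (u t) volume ∧ Integrable (fun y => ‖u t y‖ * θ t y) volume ∧
      Integrable (s t) volume := by
  filter_upwards [h.ae_memLp_two, h.aestronglyMeasurable_uncurry_velocity.prodMk_left,
    h.integrable_norm_velocity_mul.prod_right_ae, h.integrable_uncurry_source.prod_right_ae] with t hm hu hi hs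
  exact ⟨hm.integrable one_le_two, hu, hi, hs⟩

/-- **An integrable majorant of the flux integral plus mollified source**, uniform in `x`:
there is `bound ∈ L¹(0,T)` with `‖G(τ, x) + (s(τ) ⋆ k)(x)‖ ≤ bound(τ)` for a.e. `τ` and all `x`.
[folklore] -/
theorem exists_flux_bound₁ (h : IsWeakScalarTransportForcedOn T κ u s θ₀ θ) {k : UnitAddTorus d → ℝ}
    (hk : FunctionSpaces.Torus.IsSmooth k) :
    ∃ bound : ℝ → ℝ, IntegrableOn bound (Ioo 0 T) volume ∧
      ∀ᵐ τ ∂(volume.restrict (Ioo 0 T)), ∀ x,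
        ‖(∫ y, θ τ y * (-⟪u τ y, FunctionSpaces.Torus.gradient k (x - y)⟫_ℝ + κ * FunctionSpaces.Torus.laplacian k (x - y))) +
          ∫ y, s τ y * k (x - y)‖ ≤ bound τ := by
  obtain ⟨C₁, hC₁⟩ := FunctionSpaces.Torus.exists_forall_norm_le_of_continuous hk.continuous
  obtain ⟨C₂, hC₂⟩ := FunctionSpaces.Torus.exists_forall_norm_le_of_continuous hk.gradient.continuous
  obtain ⟨C₃, hC₃⟩ := FunctionSpaces.Torus.exists_forall_norm_le_of_continuous hk.laplacian.continuous
  set bound : ℝ → ℝ := fun τ => C₂ * (∫ y, ‖u τ y‖ * |θ τ y|) + |κ| * C₃ * (∫ y, |θ τ y|) +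
    C₁ * ∫ y, |s τ y| with hbound
  have hi1 : Integrable (fun t => ∫ y, ‖u t y‖ * |θ t y|) (volume.restrict (Ioo 0 T)) := by
    refine h.integrable_norm_velocity_mul.norm.integral_prod_left.congr (Eventually.of_forall fun t => ?_)
    simp [Real.norm_eq_abs]
  have hi2 : Integrable (fun t => ∫ y, |θ t y|) (volume.restrict (Ioo 0 T)) := by
    refine h.integrable_uncurry.norm.integral_prod_left.congr (Eventually.of_forall fun t => ?_)
    simp [Real.norm_eq_abs, uncurry]
  have hi3 : Integrable (fun t => ∫ y, |s t y|) (volume.restrict (Ioo 0 T)) := by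
    refine h.integrable_uncurry_source.norm.integral_prod_left.congr (Eventually.of_forall fun t => ?_)
    simp [Real.norm_eq_abs, uncurry]
  have hbi : IntegrableOn bound (Ioo 0 T) volume := by
    rw [IntegrableOn, hbound]
    exact ((hi1.const_mul C₂).add (hi2.const_mul (|κ| * C₃))).add (hi3.const_mul C₁)
  refine ⟨bound, hbi, ?_⟩
  filter_upwards [h.ae_slice_integrable₁] with τ hτ x
  have h1 : |∫ y, θ τ y * (-⟪u τ y, FunctionSpaces.Torus.gradient k (x - y)⟫_ℝ + κ * FunctionSpaces.Torus.laplacian k (x - y))| ≤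
      C₂ * (∫ y, ‖u τ y‖ * |θ τ y|) + |κ| * C₃ * ∫ y, |θ τ y| :=
    abs_fluxIntegral_le (δ := θ τ) hτ.1 hτ.2.2.1 hC₂ hC₃ κ x
  have h2 : |∫ y, s τ y * k (x - y)| ≤ C₁ * ∫ y, |s τ y| := by
    rw [← Real.norm_eq_abs]
    have hb : Integrable (fun y => C₁ * |s τ y|) volume := hτ.2.2.2.abs.const_mul C₁
    refine (norm_integral_le_of_norm_le hb (Eventually.of_forall fun y => ?_)).trans (le_of_eq ?_)
    · rw [norm_mul, Real.norm_eq_abs, mul_comm]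
      exact mul_le_mul_of_nonneg_right (hC₁ _) (abs_nonneg _)
    · exact MeasureTheory.integral_const_mul _ _
  rw [Real.norm_eq_abs]
  exact (abs_add_le _ _).trans (by rw [hbound]; linarith)

/-- **The time primitive with datum and source, simultaneously in `x`.** For integrable `θ₀`,
a.e. `t ∈ (0,T)` and *every* `x`:
`∫ θ(t,y) k(x-y) dy = ∫ θ₀(y) k(x-y) dy + ∫_{(0,t]} (G(τ, x) + ∫ s(τ,y) k(x-y) dy) dτ`
(the identity holds on a countable dense set of `x`, and the terms are continuous in `x`:
mollifications of integrable slices and a parametric integral with an integrable majorant).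
[folklore] -/
theorem ae_forall_molInt_eq_datum_add_setIntegral_flux (h : IsWeakScalarTransportForcedOn T κ u s θ₀ θ)
    (hθ₀ : Integrable θ₀ volume) {k : UnitAddTorus d → ℝ} (hk : FunctionSpaces.Torus.IsSmooth k) :
    ∀ᵐ t ∂(volume.restrict (Ioo 0 T)), ∀ x : UnitAddTorus d,
      ∫ y, θ t y * k (x - y) = (∫ y, θ₀ y * k (x - y)) +
        ∫ τ in Ioc 0 t, ((∫ y, θ τ y *
          (-⟪u τ y, FunctionSpaces.Torus.gradient k (x - y)⟫_ℝ + κ * FunctionSpaces.Torus.laplacian k (x - y))) +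
          ∫ y, s τ y * k (x - y)) := by
  obtain ⟨D, hDc, hDd⟩ := TopologicalSpace.exists_countable_dense (UnitAddTorus d)
  haveI : Countable D := hDc.to_subtype
  have hD : ∀ᵐ t ∂(volume.restrict (Ioo 0 T)), ∀ x : D,
      ∫ y, θ t y * k ((x : UnitAddTorus d) - y) = (∫ y, θ₀ y * k ((x : UnitAddTorus d) - y)) +
        ∫ τ in Ioc 0 t, ((∫ y, θ τ y *
          (-⟪u τ y, FunctionSpaces.Torus.gradient k ((x : UnitAddTorus d) - y)⟫_ℝ +
            κ * FunctionSpaces.Torus.laplacian k ((x : UnitAddTorus d) - y))) +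
          ∫ y, s τ y * k ((x : UnitAddTorus d) - y)) :=
    ae_all_iff.2 fun x => h.ae_molInt_eq_datum_add_setIntegral_flux hk x
  obtain ⟨bound, hbi, hGb⟩ := h.exists_flux_bound₁ hk
  filter_upwards [hD, h.ae_slice_integrable₁, ae_restrict_mem measurableSet_Ioo] with t ht hs' htT
  have hconv : ∀ {δ : UnitAddTorus d → ℝ}, Integrable δ volume →
      Continuous fun x => ∫ y, δ y * k (x - y) := by
    intro δ hδ
    have e : (fun x => ∫ y, δ y * k (x - y)) = δ ⋆ k := by
      funext x
      simp only [convolution_lsmul, smul_eq_mul]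
    rw [e]
    exact FunctionSpaces.Torus.continuous_convolution hδ hk.continuous
  have hcl : Continuous fun x => ∫ y, θ t y * k (x - y) := hconv hs'.1
  have hsub : Ioc 0 t ⊆ Ioo 0 T := Ioc_subset_Ioo_right htT.2
  have hcr : Continuous fun x => (∫ y, θ₀ y * k (x - y)) + ∫ τ in Ioc 0 t, ((∫ y, θ τ y *
      (-⟪u τ y, FunctionSpaces.Torus.gradient k (x - y)⟫_ℝ + κ * FunctionSpaces.Torus.laplacian k (x - y))) +
      ∫ y, s τ y * k (x - y)) := by
    refine (hconv hθ₀).add ?_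
    refine continuous_of_dominated (bound := bound) (fun x => ?_) (fun x => ?_) (hbi.mono_set hsub) ?_
    · have hkc : Continuous fun y : UnitAddTorus d => k (x - y) := hk.continuous.comp (continuous_const.sub continuous_id)
      have hGi : IntegrableOn (fun τ => (∫ y, θ τ y *
          (-⟪u τ y, FunctionSpaces.Torus.gradient k (x - y)⟫_ℝ + κ * FunctionSpaces.Torus.laplacian k (x - y))) +
          ∫ y, s τ y * k (x - y)) (Ioo 0 T) volume :=
        (h.integrable_mul_flux hk x).integral_prod_left.add (h.integrable_source_mul_continuous hkc).integral_prod_left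
      exact (hGi.mono_set hsub).aestronglyMeasurable
    · exact ae_restrict_of_ae_restrict_of_subset hsub (hGb.mono fun τ hτ => hτ x)
    · refine ae_restrict_of_ae_restrict_of_subset hsub ?_
      filter_upwards [h.ae_slice_integrable₁] with τ hτ
      exact (continuous_fluxIntegral (δ := θ τ) hτ.1 hτ.2.1 hτ.2.2.1 hk κ).add (hconv hτ.2.2.2)
  exact congrFun (Continuous.ext_on hDd hcl hcr fun x hx => ht ⟨x, hx⟩)

end IsWeakScalarTransportForcedOn

end Torus

end Literature.Analysis.FluidPDE

end
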